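import Summits.ABC.IUTFork.Repair.CandLana1
import Summits.ABC.IUTFork.Cor312PrArchShallowBridge
import Literature.NumberTheory.Transcendental.LindemannWeierstrassProofs
import HarnessLib

/-!
# REPAIR-CATALOGUE row R-LANA (RC-130 / RC-649) — Project LANA's (9-1) AS TYPED (`Repair.CandLana1.H`) at the HONEST-ARCHIMEDEAN genuine
# sharp bed (the cell's «fourth corner»): ONE explicit identity `((l+1)/24 − 1/(2l))·deĝ̲(𝔮) = ((l+5)/4)·log π`, not decided by sign,
# FALSE by the transcendence of `π` (D-0123 (C); seat abc-iut-rcat-tst-9 gen 5; container-sensitivity record for caveat (b) of catalogue v1.8)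

PROOF-ONLY file (D-0012; no definition, no `Prop` fact; class `Lana`, rows RP-L01 / RC-130 / RC-649; rung LADDER-ABC:A2; companion of
`Repair.RLana91ContainerGrain`). TAKES NO SIDE on [IUTchIII] Cor. 3.12 / [IUTchIV] Thm. 1.10, on the LANA authors, or on any author or repository;
nothing here asserts abc proved or refuted; REFUTED-AS-TYPED ≠ refuted-in-print. The kill of record of (9-1) as typed at the genuine bed
(`RLana91GenuineBed.not_H_settingPrVolSharp`, p511969) was computed at abc-iut-c312-7's `settingPrVolSharp`, whose archimedean container is TRIVIAL
(Dupuy–Hilado convention). THIS FILE evaluates the same typed (9-1) at the SAME print-normalised container WITH THE HONEST ARCHIMEDEAN PLACE —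
abc-iut-c312-7 gen 3's `settingPrVolArchSharp` over abc-iut-w5-d163's `∞`-model (the Θ-boxes at `∞` are [IUTchIV] Thm. 1.10 Step (vii)'s
`π^{j+1}·B` of log-volume `(j+1)·log π`; the `q`-volume at `∞` is `0`).

WHAT IS PROVED.
* `gap_pos_and_archLogTheta_pos`, `log_normProduct_eq_deg_qDivisor`, **`kappa_mul_ndeg_qDivisor_ne_archLogTheta`** (pilot-divisor arithmetic,
  any pilot datum `X` over any number field `F`): the pilot-degree gap `((l+1)/24 − 1/(2l))·deĝ̲(𝔮) = deĝ̲_lgp(P_Θ) − deĝ̲(P_q)` and abc-iut-S2's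
  archimedean constant `archLogTheta l = ((l+5)/4)·log π` are BOTH positive, and they are NEVER EQUAL: equality would give
  `(l²+l−12)·log N_𝔮 = 6l(l+5)[F:ℚ]·log π` with `N_𝔮 = Π_{v∈S} |κ(v)|^{ord_v(q_v)} ∈ ℕ`, i.e. `π^{6l(l+5)[F:ℚ]} = N_𝔮^{l²+l−12} ∈ ℕ`, contradicting
  the transcendence of `π` (Lindemann 1882; tree `Literature.NumberTheory.Transcendental.transcendental_pi_holds`).
* `thetaRegion3_settingPrVolArchSharp_eq`, `logvol_eq_of_mem_possibleImages_settingPrVolArchSharp`,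
  `processionNormalized_imageChoice_settingPrVolArchSharp` — at the fourth corner EVERY global possible image of the Θ-pilot object has
  procession-normalised volume `−deĝ̲_lgp(P_Θ) + 𝔼_j |S^±_{j+1}|·log π` ((Ind1)/(Ind2) act by volume-preserving maps of the MERGED container,
  abc-iut-c312-7 `adm_and_logvol_possibleImage_eq_PrArch`; the boxes do not depend on the lattice position).
* `H_settingPrVolArchSharp_iff`, `H_settingPrVolArchSharp_iff_gap_eq_archLogTheta` — (9-1) as typed ⟺ `−deĝ̲_lgp(P_Θ) + 𝔼_j |S^±_{j+1}|·log π =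
  −deĝ̲(P_q)` ⟺ `((l+1)/24 − 1/(2l))·deĝ̲(𝔮) = ((l+5)/4)·log π`; **`not_H_settingPrVolArchSharp`** — hence FALSE, for every region reading `ρ` and
  `q`-datum `qK`.

READING for the catalogue (numbers and decl names, not adjectives; no side). Container-SENSITIVITY datum for row R-LANA: along the archimedean
axis the MECHANISM of the kill changes — at the trivial-`∞` corner it is the degree inequality `deĝ̲_lgp(P_Θ) > deĝ̲(P_q)` (companion §2), at the
honest-`∞` corner the archimedean Θ-term `(j+1)·log π > 0` sits on the compensating side, the sign no longer decides, and the verdict is carried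
by Lindemann's theorem (the arithmetic nature of `log π` against the `log|κ(v)|`). The VERDICT «KILLED-AS-TYPED at the genuine sharp bed» is
the same at both corners. HONEST SCOPE: statements about OUR typed objects at OUR beds (volume-preserving (Ind1)/(Ind2), (Ind3) absorbed in the
sharp boxes, w5-d163's MODEL of the `∞`-boxes); (9-1) is the report's self-declared open goal (§10.5 p. 49); refuted-as-typed ≠
refuted-in-print; typed ≠ proved; instantiated ≠ endorsed.
[cite: LANA2026Report, §9.2 (9-1) p. 46; §10.5 p. 49] [cite: Mochizuki2012, IUTchIII Cor. 3.12 p. 173–174; proof Step (x) p. 181]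
[cite: Mochizuki2012, IUTchIV Thm. 1.10 proof Step (vii) p. 30] [cite: DupuyHilado2025, Def. 3.1.1, §2.5.4, §3.3, §3.4, Thm. 3.10.1, §4.10]
[cite: Lindemann1882, via BakerTNT1975 Ch. 1 Theorem 1.3, p. 5] [claim: Mochizuki2012, status: disputed] for every quoted construction.
-/

noncomputable section

open Set Function NumberField IsDedekindDomain

namespace Summit.ABC.IUTFork.Repair.RLana91ArchCorner

open Thm311 Thm311.Real Cor312 Cor312Vol Literature.IUT.LogThetaLattice Literature.IUT.LogVolume Literature.IUT.HodgeTheaters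
  Literature.NumberTheory.NumberFields

/-! ## §1. Pilot-divisor arithmetic: the sign does not decide at the fourth corner; Lindemann's theorem does -/

section Arithmetic

variable {F : Type} [Field F] [NumberField F] (X : PilotData F)

/-- **Both sides of the fourth-corner identity are POSITIVE**: the pilot-degree gap `((l+1)/24 − 1/(2l))·deĝ̲(𝔮) = deĝ̲_lgp(P_Θ) − deĝ̲(P_q) > 0`
(Dupuy–Hilado Thm. 3.10.1) and `((l+5)/4)·log π > 0` — so the sign argument that kills (9-1) as typed at the trivial-`∞` corner (companion `RLana91ContainerGrain` §2)
does NOT decide it here. [cite: DupuyHilado2025, §3.3, Thm. 3.10.1] [cite: Mochizuki2012, IUTchIV Thm. 1.10 proof Step (vii) p. 30] -/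
theorem gap_pos_and_archLogTheta_pos :
    0 < (((X.l : ℝ) + 1) / 24 - 1 / (2 * (X.l : ℝ))) * FinDivisor.ndeg F X.qDivisor ∧ 0 < ThetaVolumeInput.archLogTheta X.l := by
  refine ⟨?_, ThetaVolumeInput.archLogTheta_pos X.l⟩
  rw [kappa_mul_ndeg_qDivisor_eq_gap X]
  have := neg_ndegLgp_thetaPilot_lt_neg_ndeg_qPilot X
  linarith

/-- `log` of the natural number `N_𝔮 = Π_{v ∈ S} |κ(v)|^{ord_v(q_v)}` is the degree `deĝ(𝔮) = Σ_{v∈S} ord_v(q_v)·ln|κ(v)|` of the Tate-parameter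
divisor. [cite: DupuyHilado2025, §2.5.4, §3.3] -/
theorem log_normProduct_eq_deg_qDivisor :
    Real.log ((∏ v ∈ X.S, Ideal.absNorm v.asIdeal ^ (X.ordq v).toNat : ℕ) : ℝ) = FinDivisor.deg F X.qDivisor := by
  rw [X.deg_qDivisor]
  push_cast
  rw [Real.log_prod]
  · refine Finset.sum_congr rfl fun v hv => ?_
    rw [Real.log_pow]
    have h0 : ((X.ordq v).toNat : ℝ) = (X.ordq v : ℝ) := by
      have h := Int.toNat_of_nonneg (le_of_lt (X.ordq_pos hv))
      exact_mod_cast h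
    rw [h0]
    rfl
  · intro v _
    exact pow_ne_zero _ (by
      have h1 : (1 : ℝ) < (Ideal.absNorm v.asIdeal : ℝ) := by exact_mod_cast NumberField.HeightOneSpectrum.one_lt_absNorm v
      exact ne_of_gt (lt_trans zero_lt_one h1))

/-- **The fourth-corner identity is FALSE for every pilot datum over every number field** — by the TRANSCENDENCE OF `π` (Lindemann 1882, tree
`Literature.NumberTheory.Transcendental.transcendental_pi_holds`), not by size: `((l+1)/24 − 1/(2l))·deĝ̲(𝔮) = ((l+5)/4)·log π` would give
`(l²+l−12)·log N_𝔮 = 6l(l+5)[F:ℚ]·log π`, i.e. `π^{6l(l+5)[F:ℚ]} = N_𝔮^{l²+l−12} ∈ ℕ` with `N_𝔮 = Π_{v∈S} |κ(v)|^{ord_v(q_v)}`.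
[cite: Lindemann1882, via BakerTNT1975 Ch. 1 Theorem 1.3, p. 5] [cite: DupuyHilado2025, §3.3] -/
theorem kappa_mul_ndeg_qDivisor_ne_archLogTheta :
    (((X.l : ℝ) + 1) / 24 - 1 / (2 * (X.l : ℝ))) * FinDivisor.ndeg F X.qDivisor ≠ ThetaVolumeInput.archLogTheta X.l := by
  intro hE
  -- notation: `d = [F:ℚ]`, `Nq = Π |κ(v)|^{ord_v(q_v)}`, `a = l²+l−12`, `b = 6l(l+5)d`
  set d : ℕ := Module.finrank ℚ F with hd
  set Nq : ℕ := ∏ v ∈ X.S, Ideal.absNorm v.asIdeal ^ (X.ordq v).toNat with hNq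
  have hl5 := X.five_le_l
  have hlpos : (0 : ℝ) < X.l := by exact_mod_cast (show 0 < X.l by omega)
  have hdpos : (0 : ℝ) < d := FinDivisor.finrank_pos (F := F)
  have hlogN : Real.log (Nq : ℝ) = FinDivisor.deg F X.qDivisor := log_normProduct_eq_deg_qDivisor X
  -- the identity with denominators cleared: `(l²+l−12)·log Nq = 6l(l+5)d·log π`
  have hndeg : FinDivisor.ndeg F X.qDivisor = Real.log (Nq : ℝ) / d := by
    rw [FinDivisor.ndeg_apply, hlogN]
  have h1 : (((X.l : ℝ) + 1) / 24 - 1 / (2 * (X.l : ℝ))) * (Real.log (Nq : ℝ) / d) * (24 * X.l * d) =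
      ((X.l : ℝ) ^ 2 + X.l - 12) * Real.log (Nq : ℝ) := by
    field_simp
    ring
  have h2 : ThetaVolumeInput.archLogTheta X.l * (24 * X.l * d) = (6 * X.l * (X.l + 5) * d : ℝ) * Real.log Real.pi := by
    rw [ThetaVolumeInput.archLogTheta]
    ring
  have hcleared : ((X.l : ℝ) ^ 2 + X.l - 12) * Real.log (Nq : ℝ) = (6 * X.l * (X.l + 5) * d : ℝ) * Real.log Real.pi := by
    rw [← h1, ← h2, ← hndeg, hE]
  -- integer exponents
  have h12 : 12 ≤ X.l ^ 2 + X.l := by nlinarith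
  have ha : (((X.l ^ 2 + X.l - 12 : ℕ)) : ℝ) = (X.l : ℝ) ^ 2 + X.l - 12 := by
    rw [Nat.cast_sub h12]
    push_cast
    ring
  have hb : (((6 * X.l * (X.l + 5) * d : ℕ)) : ℝ) = (6 * X.l * (X.l + 5) * d : ℝ) := by push_cast; ring
  have hbpos : 0 < 6 * X.l * (X.l + 5) * d := by
    have : 0 < d := Module.finrank_pos
    positivity
  have hNpos : (0 : ℝ) < Nq := by
    rw [hNq]
    push_cast
    refine Finset.prod_pos fun v _ => pow_pos ?_ _
    have h1' : (1 : ℝ) < (Ideal.absNorm v.asIdeal : ℝ) := by exact_mod_cast NumberField.HeightOneSpectrum.one_lt_absNorm v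
    exact lt_trans zero_lt_one h1'
  -- `log (Nq^a) = log (π^b)`, hence `Nq^a = π^b`
  have hlog : Real.log ((Nq : ℝ) ^ (X.l ^ 2 + X.l - 12)) = Real.log (Real.pi ^ (6 * X.l * (X.l + 5) * d)) := by
    rw [Real.log_pow, Real.log_pow, ha, hb, hcleared]
  have hpow : (Nq : ℝ) ^ (X.l ^ 2 + X.l - 12) = Real.pi ^ (6 * X.l * (X.l + 5) * d) :=
    Real.log_injOn_pos (Set.mem_Ioi.2 (pow_pos hNpos _)) (Set.mem_Ioi.2 (pow_pos Real.pi_pos _)) hlog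
  -- `π^b` is then a natural number, hence algebraic over `ℚ` — contradicting Lindemann
  have halg : IsAlgebraic ℚ (Real.pi ^ (6 * X.l * (X.l + 5) * d)) := by
    rw [← hpow, ← Nat.cast_pow]
    exact isAlgebraic_nat _
  exact (Literature.NumberTheory.Transcendental.transcendental_pi_holds.pow hbpos) halg

end Arithmetic

/-! ## §2. The fourth corner: possible-image volumes and (9-1) as typed -/

section GenuineArch

variable {F : Type} [Field F] [NumberField F] (X : PilotData F) {logv : PadicLogs F} (hlog : LogvAnalytic logv)
  (hc : ∀ w : InfinitePlace F, w.IsComplex) (M : Type) [Field M] [NumberField M]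
  (archPk : ∀ (j : (thetaIndex X).Label) (vQ : (thetaIndex X).VQ), Set ((logShellsDH X logv).Packet j vQ))
  (archSub : ∀ (j : (thetaIndex X).Label) (v : (thetaIndex X).V),
    Set ((logShellsDH X logv).Packet j ((thetaIndex X).over v)))
  (Ψ : ℤ → ∀ v : (thetaIndex X).V, v ∈ (thetaIndex X).Vbad → Set ((logShellsDH X logv).StarPacket v))
  (act : ℤ → ∀ v : (thetaIndex X).V, v ∈ (thetaIndex X).Vbad →
    (logShellsDH X logv).StarPacket v → Module.End ℚ ((logShellsDH X logv).StarPacket v))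
  (Mmod : ℤ → ∀ j : (thetaIndex X).LabelStar, Set ((logShellsDH X logv).GlobalPacket j.1))
  (region : ℤ → ∀ j : (thetaIndex X).LabelStar, FinDivisor M → ∀ vQ : (thetaIndex X).VQ,
    Set ((logShellsDH X logv).Packet j.1 vQ))
  (frobAdm : ℤ → ℤ → ∀ (j : (thetaIndex X).Label) (vQ : (thetaIndex X).VQ),
    Set ((logShellsDH X logv).Packet j vQ) → Prop)
  (frobLogvol : ℤ → ℤ → ∀ (j : (thetaIndex X).Label) (vQ : (thetaIndex X).VQ),
    Set ((logShellsDH X logv).Packet j vQ) → ℝ)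
  (frobΨ : ℤ → ℤ → ∀ v : (thetaIndex X).V, v ∈ (thetaIndex X).Vbad → Set ((logShellsDH X logv).StarPacket v))
  (frobMmod : ℤ → ℤ → ∀ j : (thetaIndex X).LabelStar, Set ((logShellsDH X logv).GlobalPacket j.1))
  (unitImage : ℤ → ℤ → ℕ → ∀ (j : (thetaIndex X).Label) (vQ : (thetaIndex X).VQ),
    Set ((logShellsDH X logv).Packet j vQ))
  (ballImage : ℤ → ℤ → ∀ (j : (thetaIndex X).Label) (vQ : (thetaIndex X).VQ),
    Set ((logShellsDH X logv).Packet j vQ))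
  (thetaDiv : ℤ → ℤ → LgpDivisor M (thetaIndex X).lstar)
  (n : ℤ) {HT : Type} {LogLink : HT → HT → Type} {IsFull : ∀ {s t : HT}, LogLink s t → Prop}
  (lat : LGPGaussianLogThetaLattice LogLink IsFull)
  {Frd : Type} {IsoF : Frd → Frd → Type} {Ob : Frd → Type} {realify : Frd → Frd} {Strip : Type}
  {IsoS : Strip → Strip → Type} {Mv : ∀ v : (thetaIndex X).V, v ∈ (thetaIndex X).Vbad → Type}
  [∀ v h, Monoid (Mv v h)]
  (sig : GlobalLGPFrobenioidSignature (thetaIndex X).lstar (thetaIndex X).V (· ∈ (thetaIndex X).Vbad)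
    Frd IsoF Ob realify Strip IsoS Mv)
  (split : SplittingMonoids Mv) {ObΔ : Type} {N : ∀ v : (thetaIndex X).V, v ∈ (thetaIndex X).Vbad → Type}
  [∀ v h, Monoid (N v h)] (qData : QPilotData ObΔ N)
  (t : ∀ (pp : Nat.Primes) (_ : Fin X.lstar) (x : (thetaIndex X).Fibre (.inr pp)),
    haveI : Fact (pp : ℕ).Prime := ⟨pp.2⟩; kOf X pp.1 x)
  (tq : ∀ (pp : Nat.Primes) (x : (thetaIndex X).Fibre (.inr pp)), haveI : Fact (pp : ℕ).Prime := ⟨pp.2⟩; kOf X pp.1 x)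
  (ρ : (∀ v : (thetaIndex X).V, v ∈ (thetaIndex X).Vbad → Set ((logShellsDH X logv).StarPacket v)) →
    ∀ (j : (thetaIndex X).Label) (vQ : (thetaIndex X).VQ), Set ((logShellsDH X logv).Packet j vQ))
  (qK : ∀ v : (thetaIndex X).V, v ∈ (thetaIndex X).Vbad → Set ((logShellsDH X logv).StarPacket v))



/-- At the fourth corner the (Ind3)-enlarged region is the single, position-independent sharp image (the boxes are constant in the lattice
position; cf. abc-iut-c312-7 `thetaRegion3_settingPrVolSharp_eq`). [cite: DupuyHilado2025, §4.10] -/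
theorem thetaRegion3_settingPrVolArchSharp_eq (htq0 : ∀ pp x, tq pp x ≠ 0)
    (htq1 : ∀ (pp : Nat.Primes) (x : (thetaIndex X).Fibre (.inr pp)),
      haveI : Fact (pp : ℕ).Prime := ⟨pp.2⟩; placeOf X pp.1 x ∉ X.S → ‖tq pp x‖ = 1)
    (m : ℤ) (j : (thetaIndex X).Label) (vQ : (thetaIndex X).VQ) :
    (settingPrVolArchSharp X hlog hc M archPk archSub Ψ act Mmod region n lat sig split qData t tq htq0 htq1).thetaRegion3 j vQ =
      (settingPrVolArchSharp X hlog hc M archPk archSub Ψ act Mmod region n lat sig split qData t tq htq0 htq1).thetaRegion m j vQ := by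
  ext x
  simp only [Setting.thetaRegion3, Set.mem_iUnion]
  exact ⟨fun ⟨_, hm⟩ => hm, fun hx => ⟨m, hx⟩⟩

/-- **Every possible image of the Θ-pilot object at the fourth corner has the log-volume of the sharp Kummer image** (non-zero Θ-ideles):
(Ind1)/(Ind2) act through volume-preserving maps of the MERGED container, finite primes and `∞` both print-normalised (abc-iut-c312-7
`adm_and_logvol_possibleImage_eq_PrArch`), and the sharp region is admissible (`thetaRegionsAdm_settingPrVolArchSharp`).
[cite: Mochizuki2012, IUTchIII Cor. 3.12 proof Step (x) p. 181] [claim: Mochizuki2012, status: disputed] -/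
theorem logvol_eq_of_mem_possibleImages_settingPrVolArchSharp (ht0 : ∀ pp i x, t pp i x ≠ 0) (htq0 : ∀ pp x, tq pp x ≠ 0)
    (htq1 : ∀ (pp : Nat.Primes) (x : (thetaIndex X).Fibre (.inr pp)),
      haveI : Fact (pp : ℕ).Prime := ⟨pp.2⟩; placeOf X pp.1 x ∉ X.S → ‖tq pp x‖ = 1)
    (i : Fin (thetaIndex X).lstar) (vQ : (thetaIndex X).VQ) {U : Set ((logShellsDH X logv).Packet (Setting.labelSucc i) vQ)}
    (hU : U ∈ (settingPrVolArchSharp X hlog hc M archPk archSub Ψ act Mmod region n lat sig split qData t tq htq0 htq1).possibleImages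
      (Setting.labelSucc i) vQ) :
    ((situationDHVolPrArch X hlog hc M archPk archSub Ψ act Mmod region).D n).logvol (Setting.labelSucc i) vQ U =
      ((situationDHVolPrArch X hlog hc M archPk archSub Ψ act Mmod region).D n).logvol (Setting.labelSucc i) vQ
        ((settingPrVolArchSharp X hlog hc M archPk archSub Ψ act Mmod region n lat sig split qData t tq htq0 htq1).thetaRegion 0
          (Setting.labelSucc i) vQ) := by
  have hθ : ((situationDHVolPrArch X hlog hc M archPk archSub Ψ act Mmod region).D n).Adm (Setting.labelSucc i) vQ
      ((settingPrVolArchSharp X hlog hc M archPk archSub Ψ act Mmod region n lat sig split qData t tq htq0 htq1).thetaRegion3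
        (Setting.labelSucc i) vQ) := by
    rw [thetaRegion3_settingPrVolArchSharp_eq X hlog hc M archPk archSub Ψ act Mmod region n lat sig split qData t tq htq0 htq1 0]
    exact thetaRegionsAdm_settingPrVolArchSharp X hlog hc M archPk archSub Ψ act Mmod region n lat sig split qData t tq ht0 htq0 htq1
      0 i vQ
  rw [← thetaRegion3_settingPrVolArchSharp_eq X hlog hc M archPk archSub Ψ act Mmod region n lat sig split qData t tq htq0 htq1 0]
  exact (adm_and_logvol_possibleImage_eq_PrArch X hlog hc M archPk archSub Ψ act Mmod region
    (settingPrVolArchSharp X hlog hc M archPk archSub Ψ act Mmod region n lat sig split qData t tq htq0 htq1) hθ hU).2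

/-- **Every GLOBAL possible image at the fourth corner has procession-normalised volume `−deĝ̲_lgp(P_Θ) + 𝔼_j |S^±_{j+1}|·log π`** (Θ-ideles
realising `P_Θ`): packet by packet the volume is that of the sharp Kummer image (`logvol_eq_of_mem_possibleImages_settingPrVolArchSharp`), whose
procession total is abc-iut-c312-7's `processionNormalized_thetaRegion_settingPrVolArchSharp`. [cite: DupuyHilado2025, Thm. 3.10.1]
[cite: Mochizuki2012, IUTchIV Thm. 1.10 proof Step (vii) p. 30] [claim: Mochizuki2012, status: disputed] -/
theorem processionNormalized_imageChoice_settingPrVolArchSharp (ht0 : ∀ pp i x, t pp i x ≠ 0)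
    (ht : ∀ (pp : Nat.Primes) (i : Fin X.lstar) (x : (thetaIndex X).Fibre (.inr pp)),
      haveI : Fact (pp : ℕ).Prime := ⟨pp.2⟩
      Real.log ‖t pp i x‖ = -(X.thetaPilot i (placeOf X pp.1 x)) * logNorm F (placeOf X pp.1 x) /
        localDegree F (placeOf X pp.1 x))
    (htq0 : ∀ pp x, tq pp x ≠ 0)
    (htq1 : ∀ (pp : Nat.Primes) (x : (thetaIndex X).Fibre (.inr pp)),
      haveI : Fact (pp : ℕ).Prime := ⟨pp.2⟩; placeOf X pp.1 x ∉ X.S → ‖tq pp x‖ = 1)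
    (U : ImageChoice (settingPrVolArchSharp X hlog hc M archPk archSub Ψ act Mmod region n lat sig split qData t tq htq0 htq1)) :
    processionNormalized (fun i : Fin (thetaIndex X).lstar => ∑ᶠ vQ : (thetaIndex X).VQ,
        ((situationDHVolPrArch X hlog hc M archPk archSub Ψ act Mmod region).D n).logvol (Setting.labelSucc i) vQ (U.1 (i, vQ))) =
      -LgpDivisor.ndegLgp X.thetaPilot +
        processionNormalized (fun i : Fin (thetaIndex X).lstar =>
          (Fintype.card ((thetaIndex X).Caps (Setting.labelSucc i)) : ℝ) * Real.log Real.pi) := by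
  have hfun : (fun i : Fin (thetaIndex X).lstar => ∑ᶠ vQ : (thetaIndex X).VQ,
        ((situationDHVolPrArch X hlog hc M archPk archSub Ψ act Mmod region).D n).logvol (Setting.labelSucc i) vQ (U.1 (i, vQ))) =
      fun i : Fin (thetaIndex X).lstar => ∑ᶠ vQ : (thetaIndex X).VQ,
        ((situationDHVolPrArch X hlog hc M archPk archSub Ψ act Mmod region).D n).logvol (Setting.labelSucc i) vQ
          ((settingPrVolArchSharp X hlog hc M archPk archSub Ψ act Mmod region n lat sig split qData t tq htq0 htq1).thetaRegion
            ((fun (_ : Fin (thetaIndex X).lstar) (_ : (thetaIndex X).VQ) => (0 : ℤ)) i vQ) (Setting.labelSucc i) vQ) := by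
    funext i
    exact finsum_congr fun vQ => logvol_eq_of_mem_possibleImages_settingPrVolArchSharp X hlog hc M archPk archSub Ψ act Mmod
      region n lat sig split qData t tq ht0 htq0 htq1 i vQ (U.2 (i, vQ))
  rw [hfun]
  exact processionNormalized_thetaRegion_settingPrVolArchSharp X hlog hc M archPk archSub Ψ act Mmod region n lat sig split qData
    t tq ht0 ht htq0 htq1 _

/-- **(9-1) AS TYPED AT THE FOURTH CORNER ⟺ `−deĝ̲_lgp(P_Θ) + 𝔼_j |S^±_{j+1}|·log π = −deĝ̲(P_q)`** (Θ-, `q`-ideles realising `P_Θ`, `P_q`; the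
archimedean `q`-volume is `0`, abc-iut-c312-7 `negLogQ_settingPrVolArchSharp`). [cite: DupuyHilado2025, §3.4, Thm. 3.10.1]
[cite: Mochizuki2012, IUTchIV Thm. 1.10 proof Step (vii) p. 30] [cite: LANA2026Report, §9.2 (9-1) p. 46] -/
theorem H_settingPrVolArchSharp_iff (ht0 : ∀ pp i x, t pp i x ≠ 0)
    (ht : ∀ (pp : Nat.Primes) (i : Fin X.lstar) (x : (thetaIndex X).Fibre (.inr pp)),
      haveI : Fact (pp : ℕ).Prime := ⟨pp.2⟩
      Real.log ‖t pp i x‖ = -(X.thetaPilot i (placeOf X pp.1 x)) * logNorm F (placeOf X pp.1 x) /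
        localDegree F (placeOf X pp.1 x))
    (htq0 : ∀ pp x, tq pp x ≠ 0)
    (htq1 : ∀ (pp : Nat.Primes) (x : (thetaIndex X).Fibre (.inr pp)),
      haveI : Fact (pp : ℕ).Prime := ⟨pp.2⟩; placeOf X pp.1 x ∉ X.S → ‖tq pp x‖ = 1)
    (htq : ∀ (pp : Nat.Primes) (x : (thetaIndex X).Fibre (.inr pp)),
      haveI : Fact (pp : ℕ).Prime := ⟨pp.2⟩
      Real.log ‖tq pp x‖ = -(X.qPilot (placeOf X pp.1 x)) * logNorm F (placeOf X pp.1 x) /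
        localDegree F (placeOf X pp.1 x)) :
    Repair.CandLana1.H
      (LatticeSituation.ofShells (logShellsDH X logv) M archPk archSub (summandPiecesPrArch X hlog hc).Adm
        (summandPiecesPrArch X hlog hc).logvol Ψ act Mmod region frobAdm frobLogvol frobΨ frobMmod unitImage ballImage thetaDiv)
      (settingPrVolArchSharp X hlog hc M archPk archSub Ψ act Mmod region n lat sig split qData t tq htq0 htq1) ρ qK ↔
      -LgpDivisor.ndegLgp X.thetaPilot +
          processionNormalized (fun i : Fin (thetaIndex X).lstar =>
            (Fintype.card ((thetaIndex X).Caps (Setting.labelSucc i)) : ℝ) * Real.log Real.pi) =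
        -FinDivisor.ndeg F X.qPilot := by
  have hq := negLogQ_settingPrVolArchSharp X hlog hc M archPk archSub Ψ act Mmod region n lat sig split qData t tq htq0 htq1 htq
  constructor
  · rintro ⟨U, hU⟩
    have hU' := processionNormalized_imageChoice_settingPrVolArchSharp X hlog hc M archPk archSub Ψ act Mmod region n lat sig split
      qData t tq ht0 ht htq0 htq1 U
    exact hU'.symm.trans (hU.trans hq)
  · intro h
    obtain ⟨U⟩ := imageChoice_nonempty
      (settingPrVolArchSharp X hlog hc M archPk archSub Ψ act Mmod region n lat sig split qData t tq htq0 htq1)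
    exact ⟨U, (processionNormalized_imageChoice_settingPrVolArchSharp X hlog hc M archPk archSub Ψ act Mmod region n lat sig split
      qData t tq ht0 ht htq0 htq1 U).trans (h.trans hq.symm)⟩

/-- **… ⟺ `((l+1)/24 − 1/(2l))·deĝ̲(𝔮) = ((l+5)/4)·log π`** — the pilot-degree gap against abc-iut-S2's archimedean constant `archLogTheta l`
(abc-iut-w5-d235 `processionNormalized_card_caps_log_pi_eq_archLogTheta`, `kappa_mul_ndeg_qDivisor_eq_gap`). ONE explicit identity of `(F, E, l)`.
[cite: Mochizuki2012, IUTchIV Thm. 1.10 proof Step (vii) p. 30] [cite: DupuyHilado2025, Def. 3.1.1, §3.3] -/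
theorem H_settingPrVolArchSharp_iff_gap_eq_archLogTheta (ht0 : ∀ pp i x, t pp i x ≠ 0)
    (ht : ∀ (pp : Nat.Primes) (i : Fin X.lstar) (x : (thetaIndex X).Fibre (.inr pp)),
      haveI : Fact (pp : ℕ).Prime := ⟨pp.2⟩
      Real.log ‖t pp i x‖ = -(X.thetaPilot i (placeOf X pp.1 x)) * logNorm F (placeOf X pp.1 x) /
        localDegree F (placeOf X pp.1 x))
    (htq0 : ∀ pp x, tq pp x ≠ 0)
    (htq1 : ∀ (pp : Nat.Primes) (x : (thetaIndex X).Fibre (.inr pp)),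
      haveI : Fact (pp : ℕ).Prime := ⟨pp.2⟩; placeOf X pp.1 x ∉ X.S → ‖tq pp x‖ = 1)
    (htq : ∀ (pp : Nat.Primes) (x : (thetaIndex X).Fibre (.inr pp)),
      haveI : Fact (pp : ℕ).Prime := ⟨pp.2⟩
      Real.log ‖tq pp x‖ = -(X.qPilot (placeOf X pp.1 x)) * logNorm F (placeOf X pp.1 x) /
        localDegree F (placeOf X pp.1 x)) :
    Repair.CandLana1.H
      (LatticeSituation.ofShells (logShellsDH X logv) M archPk archSub (summandPiecesPrArch X hlog hc).Adm
        (summandPiecesPrArch X hlog hc).logvol Ψ act Mmod region frobAdm frobLogvol frobΨ frobMmod unitImage ballImage thetaDiv)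
      (settingPrVolArchSharp X hlog hc M archPk archSub Ψ act Mmod region n lat sig split qData t tq htq0 htq1) ρ qK ↔
      (((X.l : ℝ) + 1) / 24 - 1 / (2 * (X.l : ℝ))) * FinDivisor.ndeg F X.qDivisor = ThetaVolumeInput.archLogTheta X.l := by
  rw [H_settingPrVolArchSharp_iff X hlog hc M archPk archSub Ψ act Mmod region frobAdm frobLogvol frobΨ frobMmod unitImage ballImage
    thetaDiv n lat sig split qData t tq ρ qK ht0 ht htq0 htq1 htq, processionNormalized_card_caps_log_pi_eq_archLogTheta X,
    kappa_mul_ndeg_qDivisor_eq_gap X]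
  constructor <;> intro h <;> linarith

/-- **(9-1) AS TYPED (`Repair.CandLana1.H`, row RP-L01 / RC-130) is FALSE at the honest-archimedean genuine sharp bed** (the fourth corner
`settingPrVolArchSharp`, Θ- and `q`-ideles realising `P_Θ`, `P_q`), for every region reading `ρ` and `q`-datum `qK`: the typed (9-1) is the identity
`((l+1)/24 − 1/(2l))·deĝ̲(𝔮) = ((l+5)/4)·log π` (`H_settingPrVolArchSharp_iff_gap_eq_archLogTheta`), refuted by the transcendence of `π`
(`kappa_mul_ndeg_qDivisor_ne_archLogTheta`). Container-sensitivity record for the catalogue: at the trivial-`∞` corner the kill is the degree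
inequality (companion `RLana91ContainerGrain` §2); here the archimedean Θ-term `(j+1)·log π` is on the compensating side and the kill is Lindemann's theorem — the VERDICT is the
same, the MECHANISM is not. REFUTED-AS-TYPED at OUR setting (volume-preserving (Ind1)/(Ind2), (Ind3) absorbed in the sharp boxes, abc-iut-w5-d163's
model of the `∞`-boxes); not a statement about (9-1) in print, which its authors record as open (§10.5 p. 49).
[cite: LANA2026Report, §9.2 (9-1) p. 46; §10.5 p. 49] [cite: Lindemann1882, via BakerTNT1975 Ch. 1 Theorem 1.3, p. 5]
[cite: Mochizuki2012, IUTchIV Thm. 1.10 proof Step (vii) p. 30] [cite: DupuyHilado2025, Thm. 3.10.1] -/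
theorem not_H_settingPrVolArchSharp (ht0 : ∀ pp i x, t pp i x ≠ 0)
    (ht : ∀ (pp : Nat.Primes) (i : Fin X.lstar) (x : (thetaIndex X).Fibre (.inr pp)),
      haveI : Fact (pp : ℕ).Prime := ⟨pp.2⟩
      Real.log ‖t pp i x‖ = -(X.thetaPilot i (placeOf X pp.1 x)) * logNorm F (placeOf X pp.1 x) /
        localDegree F (placeOf X pp.1 x))
    (htq0 : ∀ pp x, tq pp x ≠ 0)
    (htq1 : ∀ (pp : Nat.Primes) (x : (thetaIndex X).Fibre (.inr pp)),
      haveI : Fact (pp : ℕ).Prime := ⟨pp.2⟩; placeOf X pp.1 x ∉ X.S → ‖tq pp x‖ = 1)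
    (htq : ∀ (pp : Nat.Primes) (x : (thetaIndex X).Fibre (.inr pp)),
      haveI : Fact (pp : ℕ).Prime := ⟨pp.2⟩
      Real.log ‖tq pp x‖ = -(X.qPilot (placeOf X pp.1 x)) * logNorm F (placeOf X pp.1 x) /
        localDegree F (placeOf X pp.1 x)) :
    ¬ Repair.CandLana1.H
      (LatticeSituation.ofShells (logShellsDH X logv) M archPk archSub (summandPiecesPrArch X hlog hc).Adm
        (summandPiecesPrArch X hlog hc).logvol Ψ act Mmod region frobAdm frobLogvol frobΨ frobMmod unitImage ballImage thetaDiv)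
      (settingPrVolArchSharp X hlog hc M archPk archSub Ψ act Mmod region n lat sig split qData t tq htq0 htq1) ρ qK := by
  rw [H_settingPrVolArchSharp_iff_gap_eq_archLogTheta X hlog hc M archPk archSub Ψ act Mmod region frobAdm frobLogvol frobΨ frobMmod
    unitImage ballImage thetaDiv n lat sig split qData t tq ρ qK ht0 ht htq0 htq1 htq]
  exact kappa_mul_ndeg_qDivisor_ne_archLogTheta X

end GenuineArch

end Summit.ABC.IUTFork.Repair.RLana91ArchCorner

end
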